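import Literature.AlgebraicGeometry.Motives.AbelianVarietyProofs
import Mathlib.AlgebraicGeometry.PullbackCarrier
import HarnessLib

/-!
# The locus where a smooth morphism has relative dimension `n` is open and closed; fibre criterion

Topic `Literature/AlgebraicGeometry/Dimension`; namespace `Literature.AlgebraicGeometry.Dimension`.  THEOREMS ONLY
(no definition, no named fact, no instance, no notation, no `sorry`).

For a morphism of schemes `f : X → Y`, Mathlib's `SmoothOfRelativeDimension n f` («locally standard smooth of relative
dimension `n`», [GortzWedhorn2020, Def. 6.14]) is a condition LOCAL ON THE SOURCE, and the relative dimension at a point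
is well defined (★ `Motives.AbelianVarietyProofs.eq_of_smoothOfRelativeDimension`: a non-empty scheme cannot be smooth
of two different relative dimensions over the same base).  Hence ([GortzWedhorn2020, Prop. 6.15 (1)]: «the set of points
where `f` is smooth of relative dimension `d` is open»; and its complement in the smooth locus, the union of the loci of
the other relative dimensions, is open as well):

* `exists_opens_smoothOfRelativeDimension_maximal` — there is a LARGEST open `U ⊆ X` on which `f` is smooth of
  relative dimension `n` (the union of all such opens; Zariski-locality on the source);
* `isClosed_of_smoothOfRelativeDimension_maximal` — if `f` is SMOOTH, that largest open is also CLOSED (every point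
  has an open neighbourhood of SOME relative dimension `m`, ★ `Motives.exists_opens_smoothOfRelativeDimension_of_smooth`,
  and `m = n` as soon as the neighbourhood meets `U`);
* `mem_of_smoothOfRelativeDimension_pullback_snd` — FIBRE CRITERION: if `f` is smooth and its base change
  `X ×_Y T → T` along some `g : T → Y` is smooth of relative dimension `n`, then every point of `X` lying over the
  image of `g` belongs to that largest open (read the relative dimension on the non-empty open piece
  `V ×_Y T ⊆ X ×_Y T` of a chart `V ∋ x` of relative dimension `m`: it is both `m` and `n`).

These are the bookkeeping facts behind «the relative dimension of a smooth morphism is locally constant on the source,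
hence constant along connected fibres» used in [MumfordFogartyKirwan1994, Ch. 6 §3, proof of Prop. 6.16 and Ch. 7 §2,
Prop. 7.3 step (II)] to cut the open sub-functor «smooth of relative dimension `g`» out of a smooth family (cell
hodgecm-mathlib, FLOOR 0, P1 sub-line F-4 layer 2, sub-stub (II-e); consumer ★-to-be
`AbelianSchemes/GroupLawLocusAssembly`).  HC_CM is proved only modulo the 7 printed citations until rung 0 closes; this
file discharges none of them.

## References
* [GortzWedhorn2020] U. Görtz, T. Wedhorn, *Algebraic Geometry I*, 2nd ed. (2020): Def. 6.14, Prop. 6.15 (1) (smooth of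
  relative dimension `d` at a point; the locus is open), Lemma 6.26.
* [MumfordFogartyKirwan1994] D. Mumford, J. Fogarty, F. Kirwan, *Geometric Invariant Theory*, 3rd ed. (1994), Ch. 6 §3
  Prop. 6.16 (p. 125), Ch. 7 §2 Prop. 7.3 step (II) (p. 132).
-/

set_option autoImplicit false

universe u

open CategoryTheory CategoryTheory.Limits AlgebraicGeometry TopologicalSpace

namespace Literature.AlgebraicGeometry.Dimension

open Literature.AlgebraicGeometry.Motives

variable {X Y : Scheme.{u}} (f : X ⟶ Y)

/-- **The largest open of relative dimension `n`.**  For any morphism `f : X → Y` and any `n` there is an open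
`U ⊆ X` such that `U ↪ X → Y` is smooth of relative dimension `n` and which contains every open with this property
(the union of all of them: smoothness of relative dimension `n` is Zariski-local on the source).
[cite: GortzWedhorn2020, Def. 6.14 and Prop. 6.15 (1)] -/
theorem exists_opens_smoothOfRelativeDimension_maximal (n : ℕ) :
    ∃ U : X.Opens, SmoothOfRelativeDimension n (U.ι ≫ f) ∧
      ∀ V : X.Opens, SmoothOfRelativeDimension n (V.ι ≫ f) → V ≤ U := by
  let J := {V : X.Opens // SmoothOfRelativeDimension n (V.ι ≫ f)}
  refine ⟨⨆ V : J, (V : X.Opens), ?_, fun V hV => le_iSup (fun V : J => (V : X.Opens)) ⟨V, hV⟩⟩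
  refine IsZariskiLocalAtSource.of_openCover (P := @SmoothOfRelativeDimension n)
    (Scheme.Opens.iSupOpenCover fun V : J => (V : X.Opens)) fun V => ?_
  obtain ⟨V, hV⟩ := V
  have h : (Scheme.Opens.iSupOpenCover fun V : J => (V : X.Opens)).f ⟨V, hV⟩ ≫ (⨆ V : J, (V : X.Opens)).ι ≫ f =
      V.ι ≫ f := by
    rw [← Category.assoc]
    exact congrArg (· ≫ f) (X.homOfLE_ι (le_iSup (fun V : J => (V : X.Opens)) ⟨V, hV⟩))
  rw [h]
  exact hV

/-- **The largest open of relative dimension `n` of a SMOOTH morphism is closed** (so it is open and closed): a point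
`x ∉ U` has an open neighbourhood `V` on which `f` is smooth of some relative dimension `m`
(★ `Motives.exists_opens_smoothOfRelativeDimension_of_smooth`); if `V` met `U`, the non-empty open `V ∩ U` would be
smooth of relative dimensions `m` and `n`, forcing `m = n` (★ `eq_of_smoothOfRelativeDimension`) and `V ⊆ U`.
[cite: GortzWedhorn2020, Prop. 6.15 (1) and Lemma 6.26] -/
theorem isClosed_of_smoothOfRelativeDimension_maximal [Smooth f] {n : ℕ} {U : X.Opens}
    (hU : SmoothOfRelativeDimension n (U.ι ≫ f))
    (hmax : ∀ V : X.Opens, SmoothOfRelativeDimension n (V.ι ≫ f) → V ≤ U) :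
    IsClosed (U : Set X) := by
  rw [← isOpen_compl_iff, isOpen_iff_forall_mem_open]
  intro x hx
  obtain ⟨V, m, hxV, hV⟩ := exists_opens_smoothOfRelativeDimension_of_smooth f x
  refine ⟨V, fun y hyV hyU => ?_, V.isOpen, hxV⟩
  -- `y ∈ V ∩ U`: the open `V ⊓ U` is non-empty, of relative dimensions `m` and `n`
  haveI : Nonempty ((V ⊓ U : X.Opens) : Scheme.{u}) := ⟨⟨y, ⟨hyV, hyU⟩⟩⟩
  have h₁ : SmoothOfRelativeDimension m ((V ⊓ U).ι ≫ f) := by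
    rw [← X.homOfLE_ι (inf_le_left : V ⊓ U ≤ V), Category.assoc]
    exact IsZariskiLocalAtSource.comp hV _
  have h₂ : SmoothOfRelativeDimension n ((V ⊓ U).ι ≫ f) := by
    rw [← X.homOfLE_ι (inf_le_right : V ⊓ U ≤ U), Category.assoc]
    exact IsZariskiLocalAtSource.comp hU _
  obtain rfl : m = n := AbelianVarietyProofs.eq_of_smoothOfRelativeDimension _ h₁ h₂
  exact hx (hmax V hV hxV)

/-- The largest open of relative dimension `n` of a smooth morphism is open and closed.
[cite: GortzWedhorn2020, Prop. 6.15 (1) and Lemma 6.26] -/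
theorem isClopen_of_smoothOfRelativeDimension_maximal [Smooth f] {n : ℕ} {U : X.Opens}
    (hU : SmoothOfRelativeDimension n (U.ι ≫ f))
    (hmax : ∀ V : X.Opens, SmoothOfRelativeDimension n (V.ι ≫ f) → V ≤ U) :
    IsClopen (U : Set X) :=
  ⟨isClosed_of_smoothOfRelativeDimension_maximal f hU hmax, U.isOpen⟩

/-- **Fibre criterion.**  Let `f : X → Y` be smooth, `U ⊆ X` the largest open of relative dimension `n`, and
`g : T → Y` a morphism whose base change `X ×_Y T → T` is smooth of relative dimension `n`.  Then every point `x` of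
`X` lying over the image of `g` belongs to `U`: a chart `V ∋ x` of some relative dimension `m` gives the non-empty
open piece `V ×_Y T ↪ X ×_Y T` (it contains a point over `(x, t)`, `f x = g t`), smooth over `T` of relative dimension
`m` (base change) and `n` (restriction), so `m = n` and `V ⊆ U`.  (Relative dimension is read on fibres:
[GortzWedhorn2020, Lemma 6.26].) [cite: GortzWedhorn2020, Prop. 6.15 (1) and Lemma 6.26] -/
theorem mem_of_smoothOfRelativeDimension_pullback_snd [Smooth f] {n : ℕ} {U : X.Opens}
    (hmax : ∀ V : X.Opens, SmoothOfRelativeDimension n (V.ι ≫ f) → V ≤ U)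
    {T : Scheme.{u}} (g : T ⟶ Y) [SmoothOfRelativeDimension n (pullback.snd f g)]
    {x : X} (hx : f x ∈ Set.range g) : x ∈ U := by
  obtain ⟨V, m, hxV, hV⟩ := exists_opens_smoothOfRelativeDimension_of_smooth f x
  obtain ⟨t, ht⟩ := hx
  -- a point of `X ×_Y T` over `(x, t)`, and a point of `V ×_X (X ×_Y T)` over it
  obtain ⟨z, hz, -⟩ := Scheme.Pullback.exists_preimage_pullback (f := f) (g := g) x t ht.symm
  obtain ⟨z', -, -⟩ := Scheme.Pullback.exists_preimage_pullback (f := V.ι) (g := pullback.fst f g)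
    (⟨x, hxV⟩ : V) z (by rw [Scheme.Opens.ι_apply, hz])
  haveI : Nonempty ↥(pullback V.ι (pullback.fst f g)) := ⟨z'⟩
  -- `V ×_Y T → T` is smooth of relative dimension `m` (base change of the chart) …
  haveI := smoothOfRelativeDimension_isStableUnderBaseChange m
  have h₁ : SmoothOfRelativeDimension m (pullback.snd (V.ι ≫ f) g) := MorphismProperty.pullback_snd _ _ hV
  have h₁' : SmoothOfRelativeDimension m (pullback.snd V.ι (pullback.fst f g) ≫ pullback.snd f g) := by
    rw [← pullbackRightPullbackFstIso_hom_snd f g V.ι]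
    exact (MorphismProperty.cancel_left_of_respectsIso (@SmoothOfRelativeDimension m) _ _).mpr h₁
  -- … and of relative dimension `n` (an open piece of `X ×_Y T → T`)
  have h₂ : SmoothOfRelativeDimension n (pullback.snd V.ι (pullback.fst f g) ≫ pullback.snd f g) :=
    IsZariskiLocalAtSource.comp ‹SmoothOfRelativeDimension n (pullback.snd f g)› _
  obtain rfl : m = n := AbelianVarietyProofs.eq_of_smoothOfRelativeDimension _ h₁' h₂
  exact hmax V hV hxV

/-- **Base change along a composite, in the `pullback.snd` currency**: `X ×_S T → T` along `w ≫ ω : T → Z → S` is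
smooth of relative dimension `n` iff the iterated base change `(X ×_S Z) ×_Z T → T` is (the two are isomorphic over
`T`, Mathlib `pullbackLeftPullbackSndIso`). [cite: GortzWedhorn2020, Remark 16.54 and Section (4.7)] -/
theorem smoothOfRelativeDimension_snd_snd_iff {S X' Z T : Scheme.{u}} (p : X' ⟶ S) (ω : Z ⟶ S) (w : T ⟶ Z)
    (n : ℕ) :
    SmoothOfRelativeDimension n (pullback.snd (pullback.snd p ω) w) ↔
      SmoothOfRelativeDimension n (pullback.snd p (w ≫ ω)) := by
  rw [← pullbackLeftPullbackSndIso_hom_snd p ω w]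
  exact MorphismProperty.cancel_left_of_respectsIso (@SmoothOfRelativeDimension n) _ _

/-- **Base change along a point of the base of a base change**: if `X ×_S Z → Z` is smooth of relative dimension `n`
and `w : T → Z` lies over `v : T → S` (`w ≫ ω = v`), then `X ×_S T → T` is smooth of relative dimension `n`
(stability under base change, [GortzWedhorn2020, Remark 16.54]). [cite: GortzWedhorn2020, Remark 16.54 and Section (4.7)] -/
theorem smoothOfRelativeDimension_snd_of_comp_eq {S X' Z T : Scheme.{u}} (p : X' ⟶ S) (ω : Z ⟶ S) {v : T ⟶ S}
    (w : T ⟶ Z) (hw : w ≫ ω = v) (n : ℕ) [SmoothOfRelativeDimension n (pullback.snd p ω)] :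
    SmoothOfRelativeDimension n (pullback.snd p v) := by
  subst hw
  haveI := smoothOfRelativeDimension_isStableUnderBaseChange n
  exact (smoothOfRelativeDimension_snd_snd_iff p ω w n).mp (MorphismProperty.pullback_snd _ _ ‹_›)

end Literature.AlgebraicGeometry.Dimension
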